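import Summits.CriticalPhenomena.PercolationContinuityZ3.Theorems.Transplant.GrigorchukPowerWitnessConj4Defs
import Summits.CriticalPhenomena.PercolationContinuityZ3.Theorems.Transplant.GrigorchukWitnessSnowballStep
import Mathlib.Combinatorics.SimpleGraph.Walk.Counting
import HarnessLib

/-!
# `Cay(𝔊^k; standard generators)` is `4k`-regular with exactly `4k` closed two-step walks — the combinatorial form of the W4 small parameter
# `p₂^{(k)}(e, e) = 1/(4k)` (S-W4-2, item (2a) of the W4 order of record)

builds on p205010 (kernel theorem, internal audit signed; external expert review pending) — nothing in this file uses p205010; pure group / graph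
combinatorics about W4's graph `Grigorchuk.gkCay k = Cay(𝔊^k; 4k standard generators)` («GrigorchukPowerWitnessConj4Defs» p682559).  Lane `prim-bschramm`,
seat `prim-bschramm-stmt` gen 41 (port pen) under lead g28's TYPING GOs #9167 / #9179 / #9232 (director-frontier g15 #9163 (3): S-items of the certified third
witness family W4; design desk p3 g41's order (2a) «exact `p₂` of SmallParam, kernel»).  Proof-only helper file (`--supports stmt-CriticalPhenomena-4575 --as
helper`): NO definition, no `@[conjecture]`, nothing about `θ(p_c)`.

WHAT IS TYPED (the COMBINATORIAL form; the tree has no simple-random-walk kernel yet — `simpleStep` lives in w-idea-1's Sketch-CARD-5 and belongs to the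
type-sketch seat's Defs file, so the return-probability sentence `p₂^{(k)}(e,e) = Σ_v (1/4k)²·[v ∼ e] = 4k/(4k)² = 1/(4k)` is a docstring consequence, not a
decl here):
* §1 ADJACENCY BY LETTERS: `gkCay_adj_iff : (gkCay k).Adj u w ↔ ∃ i y, w = u * Pi.mulSingle i (Letter.toG y)` — a neighbour is reached by ONE letter
  `a, b, c, d` in ONE coordinate (the letters are involutions, so both orientations of Mathlib's `mulCayley_adj` collapse).
* §2 THE GENERATING SET HAS EXACTLY `4k` ELEMENTS: `gkGens_eq_image` (`gkGens k` = image of `univ ×ˢ {a, x b, x c, x d}` under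
  `(i, y) ↦ Pi.mulSingle i (toG y)`), `mulSingle_toG_injective` (a letter `≠ 1` pins its coordinate, then «GrigorchukWitnessSnowballStep» `toG_injective`),
  **`card_gkGens : (gkGens k).card = 4 * k`**.
* §3 **`gkCay_degree (u) : (gkCay k).degree u = 4 * k`** for every `k` and every vertex (so `gkCay k` is `4k`-regular, `gkCay_isRegularOfDegree`).
* §4 CLOSED TWO-STEP WALKS: the generic count `card_walks_length_two_self : |{p : G.Walk u u // p.length = 2}| = G.degree u` (Mathlib's
  `walkLengthTwoEquivCommonNeighbors` at `u = v`: a closed 2-walk is «out along an edge and back») and **`gkCay_card_walks_length_two_self (u) :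
  Fintype.card {p : (gkCay k).Walk u u // p.length = 2} = 4 * k`** — the numerator of `p₂^{(k)}(e,e)`; with the `4k`-regularity, `p₂^{(k)}(e,e) = 1/(4k)`.
NOT HERE (honest): the exact `p₃ = 6k/(4k)³` and `p₄ = (48k² − 14k)/(4k)⁴` (refuter p5-g34 #9161) need the length-`≤ 4` RELATION CENSUS of `{a, b, c, d}` in `𝔊`
(Klein products and the finite-model NON-relations) — an M-sized follow-up «GrigorchukPowerClosedWords» on a GO.
[cite: BenjaminiSchramm1996, §2 (Cayley graphs)] [cite: Grigorchuk1980, definition of a, b, c, d] [cite: Woess2000, §1.B (simple random walk, p_n(x,x))]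
-/

noncomputable section

namespace Summit.CriticalPhenomena.PercolationContinuityZ3.Theorems.Transplant

namespace Grigorchuk

open SimpleGraph
open scoped Classical

/-- The four letters as a `Finset Letter` (the index set of the standard generators in one coordinate). [cite: Grigorchuk1980, definition of a, b, c, d] -/
private theorem mem_letters (y : Letter) : y ∈ ({Letter.a, .x .b, .x .c, .x .d} : Finset Letter) := by
  rcases y with _ | ⟨_ | _ | _⟩ <;> simp

/-! ### §1 Adjacency by letters -/

/-- **Neighbours in `Cay(𝔊^k; std)` are right multiples by ONE letter in ONE coordinate**: `u ∼ w ↔ w = u · mulSingle i (toG y)` for some `i < k` and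
`y ∈ {a, b, c, d}` (the letters are involutions — «GrigorchukCayleyLabelRigidity» `toG_inv` — so both orientations of `mulCayley_adj` give the same form).
[cite: BenjaminiSchramm1996, §2 (Cayley graphs)] -/
theorem gkCay_adj_iff {k : ℕ} {u w : GPow k} : (gkCay k).Adj u w ↔ ∃ i : Fin k, ∃ y : Letter, w = u * Pi.mulSingle i (Letter.toG y) := by
  constructor
  · intro h
    obtain ⟨x, -, hx, rfl⟩ := CayleyCosets.exists_letter_of_adj (gkGens k) h
    -- `x ∈ gkGens k` or `x⁻¹ ∈ gkGens k`; either way `x = mulSingle i (toG y)` (letters are involutions)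
    have key : ∀ {z : GPow k}, z ∈ gkGens k → ∃ i : Fin k, ∃ y : Letter, z = Pi.mulSingle i (Letter.toG y) := by
      intro z hz
      rw [gkGens, Finset.mem_image] at hz
      obtain ⟨⟨i, g⟩, hig, rfl⟩ := hz
      obtain ⟨y, hy⟩ := mem_gens_iff.1 (Finset.mem_product.1 hig).2
      exact ⟨i, y, by rw [hy]⟩
    rcases hx with hx | hx
    · obtain ⟨i, y, hxy⟩ := key hx
      exact ⟨i, y, by rw [hxy]⟩
    · obtain ⟨i, y, hxy⟩ := key hx
      refine ⟨i, y, ?_⟩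
      rw [← inv_inv x, hxy, ← Pi.mulSingle_inv, toG_inv]
  · rintro ⟨i, y, rfl⟩
    refine CayleyCosets.adj_mul_letter (gkGens k) (Or.inl (mulSingle_mem_gkGens i (mem_gens_iff.2 ⟨y, rfl⟩))) ?_
    rw [Ne, Pi.mulSingle_eq_one_iff]
    exact toG_ne_one y

/-! ### §2 The standard generating set has exactly `4k` elements -/

/-- `gkGens k` is the image of `Fin k × {a, b, c, d}` under `(i, y) ↦ mulSingle i (toG y)`. [cite: BenjaminiSchramm1996, §2 (Cayley graphs)] -/
theorem gkGens_eq_image (k : ℕ) :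
    gkGens k = ((Finset.univ : Finset (Fin k)) ×ˢ ({Letter.a, .x .b, .x .c, .x .d} : Finset Letter)).image
      (fun p => Pi.mulSingle p.1 (Letter.toG p.2)) := by
  ext z
  rw [gkGens, Finset.mem_image, Finset.mem_image]
  constructor
  · rintro ⟨⟨i, g⟩, hig, rfl⟩
    obtain ⟨y, hy⟩ := mem_gens_iff.1 (Finset.mem_product.1 hig).2
    exact ⟨⟨i, y⟩, Finset.mem_product.2 ⟨Finset.mem_univ _, mem_letters y⟩, by rw [hy]⟩
  · rintro ⟨⟨i, y⟩, -, rfl⟩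
    exact ⟨⟨i, Letter.toG y⟩, Finset.mem_product.2 ⟨Finset.mem_univ _, mem_gens_iff.2 ⟨y, rfl⟩⟩, rfl⟩

/-- **`(i, y) ↦ mulSingle i (toG y)` is injective** on `Fin k × Letter`: a letter is `≠ 1`, so it pins its coordinate; then `toG` is injective. [folklore] -/
theorem mulSingle_toG_injective (k : ℕ) : Function.Injective (fun p : Fin k × Letter => (Pi.mulSingle p.1 (Letter.toG p.2) : GPow k)) := by
  rintro ⟨i, y⟩ ⟨j, y'⟩ h
  simp only at h
  have hij : i = j := by
    by_contra hij
    have h1 := congr_fun h i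
    rw [Pi.mulSingle_eq_same, Pi.mulSingle_eq_of_ne hij] at h1
    exact toG_ne_one y h1
  subst hij
  have h2 := congr_fun h i
  rw [Pi.mulSingle_eq_same, Pi.mulSingle_eq_same] at h2
  rw [toG_injective h2]

/-- **`|gkGens k| = 4k`** (four letters per coordinate, all distinct). [cite: BenjaminiSchramm1996, §2 (Cayley graphs)] -/
theorem card_gkGens (k : ℕ) : (gkGens k).card = 4 * k := by
  rw [gkGens_eq_image, Finset.card_image_of_injective _ (mulSingle_toG_injective k), Finset.card_product, Finset.card_univ, Fintype.card_fin,
    mul_comm]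
  congr 1

/-! ### §3 `Cay(𝔊^k; std)` is `4k`-regular -/

/-- The neighbour finset of `u`: right translates of `u` by the `4k` generators. [cite: BenjaminiSchramm1996, §2 (Cayley graphs)] -/
theorem gkCay_neighborFinset (k : ℕ) (u : GPow k) :
    (gkCay k).neighborFinset u = ((Finset.univ : Finset (Fin k)) ×ˢ ({Letter.a, .x .b, .x .c, .x .d} : Finset Letter)).image
      (fun p => u * Pi.mulSingle p.1 (Letter.toG p.2)) := by
  ext w
  rw [mem_neighborFinset, gkCay_adj_iff, Finset.mem_image]
  constructor
  · rintro ⟨i, y, rfl⟩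
    exact ⟨⟨i, y⟩, Finset.mem_product.2 ⟨Finset.mem_univ _, mem_letters y⟩, rfl⟩
  · rintro ⟨⟨i, y⟩, -, rfl⟩
    exact ⟨i, y, rfl⟩

/-- **`Cay(𝔊^k; std)` is `4k`-regular**: `deg u = 4k` at every vertex, for every `k`. [cite: BenjaminiSchramm1996, §2 (Cayley graphs)] -/
theorem gkCay_degree (k : ℕ) (u : GPow k) : (gkCay k).degree u = 4 * k := by
  rw [← card_neighborFinset_eq_degree, gkCay_neighborFinset,
    Finset.card_image_of_injective _ (fun p q h => mulSingle_toG_injective k (mul_left_cancel h)), Finset.card_product, Finset.card_univ,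
    Fintype.card_fin, mul_comm]
  congr 1

/-- `Cay(𝔊^k; std)` is regular of degree `4k`. [cite: BenjaminiSchramm1996, §2 (Cayley graphs)] -/
theorem gkCay_isRegularOfDegree (k : ℕ) : (gkCay k).IsRegularOfDegree (4 * k) := fun u => gkCay_degree k u

/-! ### §4 Closed two-step walks: the numerator of `p₂(e, e)` -/

/-- **In any locally finite simple graph the closed walks of length `2` at `u` are in bijection with the neighbours of `u`** («out along an edge and
back»), so there are exactly `deg u` of them. [cite: Woess2000, §1.B (simple random walk, p_n(x,x))] -/
theorem card_walks_length_two_self {V : Type*} (G : SimpleGraph V) [G.LocallyFinite] (u : V) :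
    Fintype.card {p : G.Walk u u // p.length = 2} = G.degree u := by
  rw [← card_neighborSet_eq_degree]
  refine Fintype.card_congr ((G.walkLengthTwoEquivCommonNeighbors u u).trans (Equiv.setCongr ?_))
  unfold commonNeighbors
  rw [Set.inter_self]

/-- **`Cay(𝔊^k; std)` has exactly `4k` closed walks of length `2` at every vertex** — the numerator of the simple random walk's two-step return
probability: with `4k`-regularity, `p₂^{(k)}(e, e) = 4k · (1/4k)² = 1/(4k)` (the W4 card's small parameter at order 2; `p₄ = O(k⁻²)` is the follow-up).
[cite: Woess2000, §1.B (simple random walk, p_n(x,x))] -/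
theorem gkCay_card_walks_length_two_self (k : ℕ) (u : GPow k) :
    Fintype.card {p : (gkCay k).Walk u u // p.length = 2} = 4 * k := by
  rw [← gkCay_degree k u]
  convert card_walks_length_two_self (gkCay k) u

end Grigorchuk

end Summit.CriticalPhenomena.PercolationContinuityZ3.Theorems.Transplant

end
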